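import Literature.Probability.LatticeModels.BoundaryPoleGreenBounds
import Literature.Probability.LatticeModels.DomainDiscretisation
import Literature.Probability.LatticeModels.BoxDirichlet
import Literature.Analysis.Complex.KoebeInteriorChains
import HarnessLib

/-!
# Harnack's inequality in conformal coordinates (Lawler–Schramm–Werner 2004, Lemma 5.2, `k = 0`)

Topic `Literature/Probability/LatticeModels` (discrete potential theory on `ℤ²`; companion of
`LatticeHarnackOneScale.lean` and `BoundaryPoleGreenBounds.lean`, whose `harnack_box` /
`harnack_chain` are the one-scale inequality and its iteration along a chain of boxes).
G. F. Lawler, O. Schramm, W. Werner, *Conformal invariance of planar loop-erased random walks and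
uniform spanning trees*, Ann. Probab. 32 (2004), Lemma 5.2 (arXiv math/0112234, p. 27), case
`k = 0` ("a kind of Harnack inequality"):

> For all `ε > 0` […] there exists `c = c₀(ε) > 0` such that the following always holds. Let
> `δ ∈ (0, c⁻¹)` and let `D ∈ 𝔇_δ` satisfy `inrad(D) ≥ 1/2`. Let `h : V_D ∪ ∂V_D → [0, ∞)` be
> non-negative and harmonic in `V_D`. If `v ∈ V_D` satisfies `|ψ_D(v)| ≤ 1 - ε`, then
> `h(v) ≤ c h(0)`.

and its proof: "For arbitrary `v ∈ V_D` satisfying `|ψ_D(v)| ≤ 1 - ε`, as we have noted, the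
Koebe distortion theorem implies that there is an `ℓ = ℓ(ε)` […] and a sequence
`0 = v₀, v₁, …, v_ℓ = v` in `V_D` with `ℓ ≤ ℓ(ε)` such that `|v_j - v_{j-1}| ≤ dist(v_j, ∂D)/10`
for each `j = 1, …, ℓ`. Consequently, iterating the above result gives `h(0) ≥ p^ℓ h(v)`".

We prove it in lattice units (mesh `1`, inner radius large instead of mesh small — the statement
is scale invariant) with explicit constants, and in both directions along the chain:

* **`harnack_conformal`** — let `F` be a conformal map of `𝔻` onto `D = F(𝔻)` (the inverse of
  LSW's `ψ_D`), `B(F 0, ρ₀) ⊆ D`, some `b ∉ D` with `‖b - F 0‖ ≤ 2ρ₀` (so `ρ₀` is comparable to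
  the inner radius), `h ≥ 0` on `ℤ²` lattice harmonic on a set `U` containing every site of `D`,
  `0 ≤ r < 1` with `ρ₀ (1-r)² ≥ 10⁴`, and `N ≥ 11000/(1-r)⁵`. Then for `|ζ| ≤ r`, with `v` the site
  nearest to `F ζ` and `v₀` the site nearest to `F 0`:
  `(c_*/2)^N h(v₀) ≤ h(v)` and `(c_*/2)^N h(v) ≤ h(v₀)` (`c_* = maneuverConst`).

* **`lipschitz_conformal`** — Lemma 5.2, case `k = 1` (the discrete derivative estimate in
  conformal coordinates): with `ρ₀(1-r)² ≥ 4·10⁴`, `N ≥ 352000/(1-r)⁵`, for every site `x` within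
  `1` of a point `F ζ`, `|ζ| ≤ r`: `|h(x + e_k) - h(x)| ≤ 1024 C_top (2/c_*)^N h(v₀)/(ρ₀(1-r)²)`
  (interior gradient estimate `harmonic_box_gradient_le` on a box of radius `⌊ρ₀(1-r)²/256⌋` about
  `x`, whose sides are conformal-interior points at radius `(1+r)/2`, bounded by `harnack_conformal`).

The chain is `w_j = F((j/N) ζ)` (`KoebeInterior.chain`: `B(w_j, ρ₀(1-r)²/32) ⊆ D`,
`‖w_{j+1} - w_j‖ ≤ 16 ρ₀ r (1-r)⁻³/N`) rounded to nearest sites `c_j`; with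
`k = ⌊ρ₀(1-r)²/4096⌋` the boxes of radius `48k` about `c_j` lie in `D` and consecutive centres are
within `12k`, so `harnack_chain` applies. Everything is proved; no named fact.

## References

* G. F. Lawler, O. Schramm, W. Werner, Ann. Probab. 32 (2004), Lemma 5.2 and its proof
  (arXiv p. 27). [LawlerSchrammWerner2004]
-/

noncomputable section

namespace Literature.Probability.LatticeModels

open Set Metric Literature.Analysis.Complex

/-! ### Mesh points (mesh `1`) and the boxes `mW`, `mB` -/

/-- Coordinate differences of sites are bounded by the distance of their mesh points.
[folklore] -/
theorem abs_sub_apply_le_norm_meshPoint_sub (x y : Site 2) (i : Fin 2) :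
    ((|x i - y i| : ℤ) : ℝ) ≤ ‖meshPoint 1 x - meshPoint 1 y‖ := by
  have hre : (meshPoint 1 x - meshPoint 1 y).re = ((x 0 - y 0 : ℤ) : ℝ) := by push_cast; simp
  have him : (meshPoint 1 x - meshPoint 1 y).im = ((x 1 - y 1 : ℤ) : ℝ) := by push_cast; simp
  fin_cases i
  · simp only [Fin.zero_eta]
    have h := Complex.abs_re_le_norm (meshPoint 1 x - meshPoint 1 y)
    rw [hre] at h
    simpa only [Int.cast_abs] using h
  · simp only [Fin.mk_one]
    have h := Complex.abs_im_le_norm (meshPoint 1 x - meshPoint 1 y)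
    rw [him] at h
    simpa only [Int.cast_abs] using h

/-- The distance of mesh points is at most the `ℓ¹` distance of the sites. [folklore] -/
theorem norm_meshPoint_sub_le (x y : Site 2) :
    ‖meshPoint 1 x - meshPoint 1 y‖ ≤ ((|x 0 - y 0| + |x 1 - y 1| : ℤ) : ℝ) := by
  have h := Complex.norm_le_abs_re_add_abs_im (meshPoint 1 x - meshPoint 1 y)
  have hre : (meshPoint 1 x - meshPoint 1 y).re = ((x 0 - y 0 : ℤ) : ℝ) := by push_cast; simp
  have him : (meshPoint 1 x - meshPoint 1 y).im = ((x 1 - y 1 : ℤ) : ℝ) := by push_cast; simp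
  rw [hre, him] at h
  simpa only [Int.cast_abs, Int.cast_add] using h

/-- A site whose mesh point is within `12k` of that of `c` lies in the small box `mB c k`.
[folklore] -/
theorem mem_mB_of_norm_le {x c : Site 2} {k : ℕ} (h : ‖meshPoint 1 x - meshPoint 1 c‖ ≤ 12 * k) :
    x ∈ mB c k := by
  have h0 : ((|x 0 - c 0| : ℤ) : ℝ) ≤ 12 * k := (abs_sub_apply_le_norm_meshPoint_sub x c 0).trans h
  have h1 : ((|x 1 - c 1| : ℤ) : ℝ) ≤ 12 * k := (abs_sub_apply_le_norm_meshPoint_sub x c 1).trans h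
  have h0' : (|x 0 - c 0| : ℤ) ≤ 12 * k := by exact_mod_cast h0
  have h1' : (|x 1 - c 1| : ℤ) ≤ 12 * k := by exact_mod_cast h1
  exact ⟨h0', h1'⟩

/-- Sites of the big box `mW c k` have mesh points within `96k` of that of `c`. [folklore] -/
theorem norm_sub_le_of_mem_mW {x c : Site 2} {k : ℕ} (h : x ∈ mW c k) :
    ‖meshPoint 1 x - meshPoint 1 c‖ ≤ 96 * k := by
  obtain ⟨h0, h1⟩ := h
  have hsum : (|x 0 - c 0| + |x 1 - c 1| : ℤ) ≤ 96 * k := by linarith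
  have hsum' : ((|x 0 - c 0| + |x 1 - c 1| : ℤ) : ℝ) ≤ ((96 * k : ℤ) : ℝ) := by exact_mod_cast hsum
  have h2 := norm_meshPoint_sub_le x c
  push_cast at hsum' h2 ⊢
  linarith

/-- The mesh point of the nearest site is within `1` of the point. [folklore] -/
theorem norm_meshPoint_nearestSite_sub_le (z : ℂ) : ‖meshPoint 1 (nearestSite 1 z) - z‖ ≤ 1 := by
  have h := dist_meshPoint_nearestSite_le one_pos z
  rwa [dist_eq_norm] at h

/-! ### Harnack's inequality in conformal coordinates -/

/-- **Harnack's inequality in conformal coordinates** (Lawler–Schramm–Werner 2004, Lemma 5.2,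
case `k = 0`, both directions). Let `F` be holomorphic and injective on `𝔻` with
`B(F 0, ρ₀) ⊆ F(𝔻)` and an omitted value `b ∉ F(𝔻)` with `‖b - F 0‖ ≤ 2ρ₀`; let `h ≥ 0` be
lattice harmonic on a set `U ⊆ ℤ²` containing every site whose mesh point lies in `F(𝔻)`; let
`r < 1` with `ρ₀ (1-r)² ≥ 10⁴` and `N ≥ 11000/(1-r)⁵`. Then for every `|ζ| ≤ r`, writing `v`,
`v₀` for the sites nearest to `F ζ`, `F 0`: `(c_*/2)^N h(v₀) ≤ h(v)` and `(c_*/2)^N h(v) ≤ h(v₀)`.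
Proof: the Koebe chain `w_j = F((j/N)ζ)` (`KoebeInterior.chain`) rounded to nearest sites is a
chain of boxes of radius `48k`, `k = ⌊ρ₀(1-r)²/4096⌋`, inside `F(𝔻)` with consecutive centres
within `12k`; apply `harnack_chain` forwards and backwards.
[cite: LawlerSchrammWerner2004, Lemma 5.2] -/
theorem harnack_conformal {F : ℂ → ℂ} (hF : DifferentiableOn ℂ F (ball 0 1))
    (hinj : InjOn F (ball 0 1)) {ρ₀ : ℝ} (hρ₀ : 0 < ρ₀) (hsub : ball (F 0) ρ₀ ⊆ F '' ball 0 1)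
    {b : ℂ} (hb : b ∉ F '' ball 0 1) (hbρ : ‖b - F 0‖ ≤ 2 * ρ₀)
    {h : Site 2 → ℝ} (hpos : ∀ w, 0 ≤ h w) {U : Set (Site 2)} (hh : IsLatticeHarmonicOn h U)
    (hU : ∀ x : Site 2, meshPoint 1 x ∈ F '' ball 0 1 → x ∈ U)
    {r : ℝ} (hr : r < 1) (hbig : 10000 ≤ ρ₀ * (1 - r) ^ 2)
    {N : ℕ} (hN : 11000 / (1 - r) ^ 5 ≤ N) {ζ : ℂ} (hζ : ‖ζ‖ ≤ r) :
    (maneuverConst / 2) ^ N * h (nearestSite 1 (F 0)) ≤ h (nearestSite 1 (F ζ)) ∧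
      (maneuverConst / 2) ^ N * h (nearestSite 1 (F ζ)) ≤ h (nearestSite 1 (F 0)) := by
  have hr0 : 0 ≤ r := (norm_nonneg _).trans hζ
  have h1r : 0 < 1 - r := by linarith
  have h1r1 : 1 - r ≤ 1 := by linarith
  set A : ℝ := ρ₀ * (1 - r) ^ 2 with hA
  have hA0 : 0 ≤ A := by positivity
  -- `(1 - r)^5 ≤ 1`, so `N ≥ 11000 ≥ 1`
  have hpow5 : (1 - r) ^ 5 ≤ 1 := pow_le_one₀ h1r.le h1r1
  have hpow5' : 0 < (1 - r) ^ 5 := pow_pos h1r 5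
  have hNr : (11000 : ℝ) ≤ N := by
    have : (11000 : ℝ) ≤ 11000 / (1 - r) ^ 5 := by
      rw [le_div_iff₀ hpow5']; nlinarith
    exact this.trans hN
  have hN0 : 0 < N := by exact_mod_cast (show (0 : ℝ) < N by linarith)
  have hNpos : (0 : ℝ) < N := by exact_mod_cast hN0
  -- the box scale
  set k : ℕ := ⌊A / 4096⌋₊ with hk
  have hkle : (k : ℝ) ≤ A / 4096 := Nat.floor_le (by positivity)
  have hklt : A / 4096 < k + 1 := Nat.lt_floor_add_one _
  have hkpos : 0 < k := by
    have : (1 : ℝ) < k := by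
      have : (10000 : ℝ) / 4096 ≤ A / 4096 := by gcongr
      linarith
    exact_mod_cast (show (0 : ℝ) < k by linarith)
  -- the Koebe chain
  obtain ⟨hw0, hwN, hball, hstep⟩ :=
    KoebeInterior.chain hF hinj hρ₀ hsub hb hbρ hζ hr hN0
  set w : ℕ → ℂ := fun j ↦ F ((j / N : ℝ) * ζ) with hw
  set c : ℕ → Site 2 := fun j ↦ nearestSite 1 (w j) with hc
  have hc0 : c 0 = nearestSite 1 (F 0) := by
    show nearestSite 1 (F (((0 : ℕ) / N : ℝ) * ζ)) = _
    simp
  have hcN : c N = nearestSite 1 (F ζ) := by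
    show nearestSite 1 (F (((N : ℕ) / N : ℝ) * ζ)) = _
    rw [div_self hNpos.ne']; simp
  -- (1) the big boxes lie in `U`
  have hbox : ∀ j ≤ N, IsLatticeHarmonicOn h (mW (c j) k) := by
    intro j hj x hx
    refine hh x (hU x (hball j hj ?_))
    rw [mem_ball, dist_eq_norm]
    have h1 := norm_sub_le_of_mem_mW hx
    have h2 := norm_meshPoint_nearestSite_sub_le (w j)
    calc ‖meshPoint 1 x - F ((j / N : ℝ) * ζ)‖
        = ‖(meshPoint 1 x - meshPoint 1 (c j)) + (meshPoint 1 (c j) - w j)‖ := by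
          simp only [hc, hw, sub_add_sub_cancel]
      _ ≤ ‖meshPoint 1 x - meshPoint 1 (c j)‖ + ‖meshPoint 1 (c j) - w j‖ := norm_add_le _ _
      _ ≤ 96 * k + 1 := add_le_add h1 h2
      _ ≤ 96 * (A / 4096) + 1 := by gcongr
      _ < ρ₀ * (1 - r) ^ 2 / 32 := by rw [← hA]; nlinarith
  -- (2) consecutive centres are within `12k`
  have hsteps : ∀ j < N, c (j + 1) ∈ mB (c j) k := by
    intro j hj
    refine mem_mB_of_norm_le ?_
    have h1 := norm_meshPoint_nearestSite_sub_le (w (j + 1))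
    have h2 := norm_meshPoint_nearestSite_sub_le (w j)
    have h3 := hstep j hj
    have hρ16 : 8 * (2 * ρ₀) / (1 - r) ^ 3 * (r / N) ≤ 16 * A / 11000 := by
      -- `r ≤ 1`, `1/N ≤ (1-r)^5/11000`
      have hN' : (1 : ℝ) / N ≤ (1 - r) ^ 5 / 11000 := by
        rw [div_le_div_iff₀ hNpos (by norm_num)]
        have := (div_le_iff₀ hpow5').1 hN
        linarith
      have hp3 : 0 < (1 - r) ^ 3 := pow_pos h1r 3
      calc 8 * (2 * ρ₀) / (1 - r) ^ 3 * (r / N) ≤ 8 * (2 * ρ₀) / (1 - r) ^ 3 * (1 / N) := by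
            gcongr
        _ ≤ 8 * (2 * ρ₀) / (1 - r) ^ 3 * ((1 - r) ^ 5 / 11000) := by gcongr
        _ = 16 * A / 11000 := by
            rw [hA]; field_simp; ring
    calc ‖meshPoint 1 (c (j + 1)) - meshPoint 1 (c j)‖
        = ‖(meshPoint 1 (c (j + 1)) - w (j + 1)) + (w (j + 1) - w j) - (meshPoint 1 (c j) - w j)‖ := by
          ring_nf
      _ ≤ ‖meshPoint 1 (c (j + 1)) - w (j + 1)‖ + ‖w (j + 1) - w j‖ + ‖meshPoint 1 (c j) - w j‖ := by
          refine (norm_sub_le _ _).trans ?_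
          gcongr
          exact norm_add_le _ _
      _ ≤ 1 + 8 * (2 * ρ₀) / (1 - r) ^ 3 * (r / N) + 1 := by
          gcongr
      _ ≤ 2 + 16 * A / 11000 := by linarith
      _ ≤ 12 * (A / 4096 - 1) := by nlinarith
      _ ≤ 12 * k := by linarith
  -- forward chain
  have hfwd := harnack_chain hpos hkpos c N hbox hsteps
  rw [hc0, hcN] at hfwd
  -- backward chain
  set c' : ℕ → Site 2 := fun j ↦ c (N - j) with hc'
  have hbox' : ∀ j ≤ N, IsLatticeHarmonicOn h (mW (c' j) k) := fun j _ ↦ hbox (N - j) (Nat.sub_le N j)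
  have hsteps' : ∀ j < N, c' (j + 1) ∈ mB (c' j) k := by
    intro j hj
    have hidx : N - j = (N - (j + 1)) + 1 := by omega
    have hm := hsteps (N - (j + 1)) (by omega)
    rw [← hidx] at hm
    -- symmetry of the box relation
    obtain ⟨hm0, hm1⟩ := hm
    refine ⟨?_, ?_⟩
    · simpa only [hc', abs_sub_comm] using hm0
    · simpa only [hc', abs_sub_comm] using hm1
  have hbwd := harnack_chain hpos hkpos c' N hbox' hsteps'
  have hc'0 : c' 0 = nearestSite 1 (F ζ) := by simp only [hc', Nat.sub_zero]; exact hcN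
  have hc'N : c' N = nearestSite 1 (F 0) := by simp only [hc', Nat.sub_self]; exact hc0
  rw [hc'0, hc'N] at hbwd
  exact ⟨hfwd, hbwd⟩

/-! ### The Lipschitz bound in conformal coordinates (Lemma 5.2, `k = 1`) -/

/-- **Discrete derivative estimate in conformal coordinates** (Lawler–Schramm–Werner 2004,
Lemma 5.2, case `k = 1`: "`|∂^δ_a h(v)| ≤ c h(0)`" for `|ψ_D(v)| ≤ 1 - ε`; in lattice units the
discrete derivative of mesh `1` is `O(h(0)/inrad)`). In the setting of `harnack_conformal`, with
`ρ₀ (1-r)² ≥ 4·10⁴` and `N ≥ 352000/(1-r)⁵`: for every site `x` whose mesh point is within `1` of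
a point `F ζ`, `|ζ| ≤ r`, and every lattice direction `e_k`,
`|h(x + e_k) - h(x)| ≤ 1024 C_top (2/c_*)^N h(v₀) / (ρ₀ (1-r)²)`, `v₀` the site nearest to `F 0`.
Proof (LSW: "the case `k = 1` now follows from Lemma 5.1 applied with `v` translated to `0`"):
the interior gradient estimate `harmonic_box_gradient_le` on the box of radius
`q = ⌊ρ₀(1-r)²/256⌋` about `x`, which lies in `F(𝔻)` (`KoebeInterior.ball_subset_image_of_norm_le`)
and whose sides consist of conformal-interior points `F ζ'`, `|ζ'| ≤ (1+r)/2`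
(`KoebeInterior.exists_apply_eq_of_norm_sub_lt`), where `h ≤ (2/c_*)^N h(v₀)` by
`harnack_conformal`. [cite: LawlerSchrammWerner2004, Lemma 5.2] -/
theorem lipschitz_conformal {F : ℂ → ℂ} (hF : DifferentiableOn ℂ F (ball 0 1))
    (hinj : InjOn F (ball 0 1)) {ρ₀ : ℝ} (hρ₀ : 0 < ρ₀) (hsub : ball (F 0) ρ₀ ⊆ F '' ball 0 1)
    {b : ℂ} (hb : b ∉ F '' ball 0 1) (hbρ : ‖b - F 0‖ ≤ 2 * ρ₀)
    {h : Site 2 → ℝ} (hpos : ∀ w, 0 ≤ h w) {U : Set (Site 2)} (hh : IsLatticeHarmonicOn h U)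
    (hU : ∀ x : Site 2, meshPoint 1 x ∈ F '' ball 0 1 → x ∈ U)
    {r : ℝ} (hr : r < 1) (hbig : 40000 ≤ ρ₀ * (1 - r) ^ 2)
    {N : ℕ} (hN : 352000 / (1 - r) ^ 5 ≤ N) {ζ : ℂ} (hζ : ‖ζ‖ ≤ r)
    {x : Site 2} (hx : ‖meshPoint 1 x - F ζ‖ ≤ 1) (k : Fin 4) :
    |h (x + cornerUnit k) - h x| ≤
      1024 * topGradConst * (2 / maneuverConst) ^ N * h (nearestSite 1 (F 0)) / (ρ₀ * (1 - r) ^ 2) := by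
  have hr0 : 0 ≤ r := (norm_nonneg _).trans hζ
  have h1r : 0 < 1 - r := by linarith
  set A : ℝ := ρ₀ * (1 - r) ^ 2 with hA
  have hA0 : 0 < A := by positivity
  have hc := maneuverConst_pos
  have hK := topGradConst_pos
  set v₀ : Site 2 := nearestSite 1 (F 0) with hv₀
  set M : ℝ := (2 / maneuverConst) ^ N * h v₀ with hM
  have hM0 : 0 ≤ M := mul_nonneg (by positivity) (hpos v₀)
  -- the box radius
  set q : ℕ := ⌊A / 256⌋₊ with hq
  have hqle : (q : ℝ) ≤ A / 256 := Nat.floor_le (by positivity)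
  have hqlt : A / 256 < q + 1 := Nat.lt_floor_add_one _
  have hq8 : 8 ≤ q := by
    have : (8 : ℝ) ≤ q := by
      have : (40000 : ℝ) / 256 ≤ A / 256 := by gcongr
      linarith
    exact_mod_cast this
  have hN16 : 16 ≤ 2 * q := by omega
  have h2q : A / 256 ≤ (2 * q : ℕ) := by push_cast; linarith
  -- sites within `ℓ^∞`-distance `q` of `x` are conformal-interior points at radius `(1+r)/2`
  set r' : ℝ := (1 + r) / 2 with hr'
  have hr'1 : r' < 1 := by rw [hr']; linarith
  have h1r' : 1 - r' = (1 - r) / 2 := by rw [hr']; ring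
  have hbig' : 10000 ≤ ρ₀ * (1 - r') ^ 2 := by rw [h1r']; nlinarith
  have hN' : 11000 / (1 - r') ^ 5 ≤ N := by
    rw [h1r', div_pow]
    have : (11000 : ℝ) / ((1 - r) ^ 5 / 2 ^ 5) = 352000 / (1 - r) ^ 5 := by
      field_simp; norm_num
    rw [this]; exact hN
  have hnear : ∀ y : Site 2, |y 0 - x 0| ≤ q → |y 1 - x 1| ≤ q → h y ≤ M ∧ y ∈ U := by
    intro y hy0 hy1
    have hdist : ‖meshPoint 1 y - F ζ‖ < (1 - r) / 2 * ρ₀ * (1 - r) / 32 := by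
      have h1 : ‖meshPoint 1 y - meshPoint 1 x‖ ≤ 2 * q := by
        have := norm_meshPoint_sub_le y x
        have h2 : ((|y 0 - x 0| + |y 1 - x 1| : ℤ) : ℝ) ≤ ((q + q : ℤ) : ℝ) := by
          exact_mod_cast add_le_add hy0 hy1
        push_cast at this h2 ⊢
        linarith
      calc ‖meshPoint 1 y - F ζ‖ = ‖(meshPoint 1 y - meshPoint 1 x) + (meshPoint 1 x - F ζ)‖ := by
            rw [sub_add_sub_cancel]
        _ ≤ ‖meshPoint 1 y - meshPoint 1 x‖ + ‖meshPoint 1 x - F ζ‖ := norm_add_le _ _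
        _ ≤ 2 * q + 1 := add_le_add h1 hx
        _ ≤ 2 * (A / 256) + 1 := by gcongr
        _ < (1 - r) / 2 * ρ₀ * (1 - r) / 32 := by rw [hA] at *; nlinarith
    obtain ⟨ζ', hζ'ζ, -, hFζ'⟩ := KoebeInterior.exists_apply_eq_of_norm_sub_lt hF hinj hρ₀ hsub hζ hr
      (by linarith : 0 < (1 - r) / 2) (by linarith) hdist
    have hζ' : ‖ζ'‖ ≤ r' := by
      have : ‖ζ'‖ ≤ ‖ζ' - ζ‖ + ‖ζ‖ := by
        calc ‖ζ'‖ = ‖(ζ' - ζ) + ζ‖ := by rw [sub_add_cancel]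
          _ ≤ ‖ζ' - ζ‖ + ‖ζ‖ := norm_add_le _ _
      rw [hr']; linarith
    have hyF : meshPoint 1 y ∈ F '' ball 0 1 := by
      rw [← hFζ']
      exact ⟨ζ', mem_ball_zero_iff.2 (hζ'.trans_lt hr'1), rfl⟩
    refine ⟨?_, hU y hyF⟩
    have hH := (harnack_conformal hF hinj hρ₀ hsub hb hbρ hpos hh hU hr'1 hbig' hN' hζ').2
    rw [hFζ', nearestSite_meshPoint one_ne_zero] at hH
    -- `(c_*/2)^N h y ≤ h v₀`
    have hcN : 0 < (maneuverConst / 2) ^ N := by positivity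
    rw [hM, div_pow, show (2 : ℝ) ^ N / maneuverConst ^ N = ((maneuverConst / 2) ^ N)⁻¹ by
      rw [div_pow, inv_div]]
    rw [← div_eq_inv_mul, le_div_iff₀ hcN, mul_comm]
    exact hH
  -- harmonicity on the box interior and the bound on the sides
  have hharm : IsLatticeHarmonicOn h (boxInterior (cornerOf x q) (2 * q)) := by
    intro y hy
    obtain ⟨k0, k0', k1, k1'⟩ := hy
    simp only [cornerOf, Matrix.cons_val_zero, Matrix.cons_val_one] at k0 k0' k1 k1'
    push_cast at k0' k1'
    refine hh y (hnear y ?_ ?_).2 <;> rw [abs_le] <;> constructor <;> omega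
  have hsides : ∀ i : ℕ, 0 < i → i < 2 * q →
      |h ![cornerOf x q 0 + i, cornerOf x q 1 + (2 * q : ℕ)]| ≤ M ∧
      |h ![cornerOf x q 0 + i, cornerOf x q 1]| ≤ M ∧
      |h ![cornerOf x q 0, cornerOf x q 1 + i]| ≤ M ∧
      |h ![cornerOf x q 0 + (2 * q : ℕ), cornerOf x q 1 + i]| ≤ M := by
    intro i hi hiq
    have habs : ∀ y : Site 2, |y 0 - x 0| ≤ q → |y 1 - x 1| ≤ q → |h y| ≤ M := fun y hy0 hy1 ↦ by
      rw [abs_of_nonneg (hpos y)]; exact (hnear y hy0 hy1).1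
    refine ⟨habs _ ?_ ?_, habs _ ?_ ?_, habs _ ?_ ?_, habs _ ?_ ?_⟩
    all_goals
      simp only [cornerOf, Matrix.cons_val_zero, Matrix.cons_val_one]
      push_cast
      rw [abs_le]; constructor <;> omega
  have hgrad := harmonic_box_gradient_le (cornerOf x q) (2 * q) hN16 hharm hM0 hsides
    (mem_boxMiddle_cornerOf x q) k
  refine hgrad.trans ?_
  -- `4 K M / (2q) ≤ 1024 K M / A`
  have h2q0 : (0 : ℝ) < (2 * q : ℕ) := by positivity
  rw [div_le_div_iff₀ h2q0 hA0, hM]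
  have hKM : 0 ≤ topGradConst * ((2 / maneuverConst) ^ N * h v₀) := mul_nonneg hK.le hM0
  nlinarith [mul_le_mul_of_nonneg_left h2q hKM]

end Literature.Probability.LatticeModels
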